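import Summits.ResolutionOfSingularities.ResolutionOfSingularities.Theorems.MarkedTransferCampaignW46MohWindowSurfaceStallThreadRoot
import Summits.ResolutionOfSingularities.ResolutionOfSingularities.Theorems.MarkedTransferCampaignW46MohWindowSurfaceShear
import HarnessLib

/-!
# [OURS · L1 W4.6 rung (iii-2), EVERY `p`] Surface Moh window — THE ORIGIN CHART OF A NON-DROPPING CHILD: for a suitable coefficient window
# presentation `(x, y, z)` of the centre in HEAVY NORMAL FORM, a non-dropping singular child is the ORIGIN of the chart `x`
# (cell res-hironaka, LADDER-RESOLUTION rung L, D-0089; seat res-L1-s46-pv-5 gen 5; host MarkedTransfer,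
# `--supports stmt-ResolutionOfSingularities-16155 --as helper`; statement file `…CampaignW46MohWindowSurface.lean`)

HONEST FRAMING. Nothing here is a statement of H. Hironaka's manuscript [Hironaka2017] and nothing here asserts that any
statement of it holds. THEOREMS about the OURS regime `CampaignW46.Regime.mohWindowSurface` (o1 §5; every `p`, every `K`). Combining
`…StallThreadRoot.lean` (a non-dropping singular child lies on the exceptional line over a `κ`-rational heavy root — for EVERY
presentation), `…Shear.lean` (heavy normal form: shear the root to `0`; swap `x ↔ y` first if the root is seen in the chart `y`) and two
polynomial facts (a nonzero polynomial of degree `< 2p` divisible by `X^p` has no OTHER `p`-fold linear factor; its reversal has none at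
all): **for a non-dropping singular point `x′` over an admitted centre `s` there is a coefficient window presentation `c = (x, y, z)` of
`𝔪_s`, `J_s = (z^p + Σ a_i x^{d−i} y^i)` with `a_0, …, a_{p−1} ∈ 𝔪_s` (HEAVY NORMAL FORM), such that `x′` is THE ORIGIN of the Rees chart `x`:
a chart morphism `q : Spec B_0 → Z′` over `Spec 𝒪_{Z,s}` computing the local ring at a prime `w ∋ x, y/x, z/x` with `q w = x′`**
(`exists_originChart_of_le_residualOrder`); and the thread form along an infinite in-regime sequence
(`PermissibleRun.exists_stalling_thread_origin`). This is the literal input («`x′ = (x, y/x, z/x)`-origin over a heavy point, at every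
stall/growth hit of an infinite thread») of a formal-coordinates entrance door for the open non-tame rung at `p ≥ 3`. AI-written; AI review
is weaker than expert review. No `sorry`; axioms standard. [ZariskiSamuel1960] [Matsumura1987] [HauserWagner2014] [CossartPiltant2008]
-/

noncomputable section

set_option linter.dupNamespace false -- mandated namespace of this single-conjunct summit

open CategoryTheory AlgebraicGeometry TopologicalSpace IsLocalRing

namespace Summit.ResolutionOfSingularities.ResolutionOfSingularities.Theorems

namespace CampaignW46

open Literature.AlgebraicGeometry.Resolution
open Literature.AlgebraicGeometry.Hironaka2017.S02Preliminaries
open Literature.AlgebraicGeometry.Hironaka2017.Datum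
open Literature.AlgebraicGeometry.Hironaka2017.S16Proof
open Scheme.IdealSheafData
open Polynomial

universe u

namespace MohWindowSurface

/-! ## 1. Polynomial facts about `p`-fold linear factors in degree `< 2p` -/

section Poly

variable {κ : Type*} [Field κ]

/-- A nonzero polynomial of degree `< 2p` divisible by `X^p` has no `p`-fold linear factor `(αX + β)^p` with `β ≠ 0`. [folklore] -/
theorem eq_zero_of_X_pow_dvd_of_linear_pow_dvd {p : ℕ} {F : κ[X]} (hF0 : F ≠ 0) (hdeg : F.natDegree < 2 * p)
    (hX : X ^ p ∣ F) {α β : κ} (hα : α ≠ 0) (hL : (C α * X + C β) ^ p ∣ F) : β = 0 := by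
  by_contra hβ
  obtain ⟨G, hG⟩ := hX
  have hG0 : G ≠ 0 := by rintro rfl; exact hF0 (by rw [hG, mul_zero])
  have hGdeg : G.natDegree < p := by
    have := hdeg
    rw [hG, natDegree_mul (pow_ne_zero _ X_ne_zero) hG0, natDegree_pow, natDegree_X] at this
    omega
  -- the linear factor is prime and does not divide `X^p` (its root `-β/α` is not a root of `X`)
  have hprime : Prime (C α * X + C β) := (irreducible_of_degree_eq_one (degree_linear hα)).prime
  have hndvd : ¬ C α * X + C β ∣ X ^ p := by
    intro h
    have hX1 : C α * X + C β ∣ X := hprime.dvd_of_dvd_pow h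
    have h0 : eval (-(β / α)) (C α * X + C β) = 0 := by
      simp only [eval_add, eval_mul, eval_C, eval_X]
      field_simp
      ring
    have := eval_eq_zero_of_dvd_of_eval_eq_zero hX1 h0
    rw [eval_X, neg_eq_zero, div_eq_zero_iff] at this
    rcases this with h1 | h1
    · exact hβ h1
    · exact hα h1
  have hGdvd : (C α * X + C β) ^ p ∣ G := hprime.pow_dvd_of_dvd_mul_left p hndvd (hG ▸ hL)
  have h1 : ((C α * X + C β) ^ p).natDegree ≤ G.natDegree := natDegree_le_of_dvd hGdvd hG0
  rw [natDegree_pow, natDegree_linear hα, mul_one] at h1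
  omega

/-- A nonzero polynomial of degree `< p` has no `p`-fold linear factor. [folklore] -/
theorem not_linear_pow_dvd_of_natDegree_lt {p : ℕ} {G : κ[X]} (hG0 : G ≠ 0) (hdeg : G.natDegree < p) {α β : κ} (hα : α ≠ 0) :
    ¬ (C α * X + C β) ^ p ∣ G := fun h => by
  have h1 : ((C α * X + C β) ^ p).natDegree ≤ G.natDegree := natDegree_le_of_dvd h hG0
  rw [natDegree_pow, natDegree_linear hα, mul_one] at h1
  omega

/-- The reversal of the residue polynomial of the chart `y`: `Σ_{k ≤ d} C(b k) X^{d−k} = Σ_{k ≤ d} C(b (d−k)) X^k`. [folklore] -/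
theorem residuePoly_reflect (d : ℕ) (b : ℕ → κ) :
    ∑ k ∈ Finset.range (d + 1), C (b k) * X ^ (d - k) = ∑ k ∈ Finset.range (d + 1), C (b (d - k)) * X ^ k := by
  have h := Finset.sum_range_reflect (fun k => C (b k) * X ^ (d - k)) (d + 1)
  rw [← h]
  refine Finset.sum_congr rfl fun k hk => ?_
  have hkd : k ≤ d := Nat.lt_succ_iff.mp (Finset.mem_range.mp hk)
  simp only [show d + 1 - 1 - k = d - k from by omega, Nat.sub_sub_self hkd]

/-- **If `X^p` divides `F = Σ_{j ≤ d} C(b j) X^j` (`b j = 0` for `j < p`), `d < 2p`, `F ≠ 0`, then the REVERSAL `Σ C(b j) X^{d−j}` has NO `p`-fold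
linear factor** (its degree is `≤ d − p < p`). [folklore] -/
theorem not_linear_pow_dvd_reflect {p d : ℕ} (hd2 : d < 2 * p) (b : ℕ → κ) (hb : ∀ j < p, b j = 0) (hne : ∃ j ≤ d, b j ≠ 0)
    {α β : κ} (hα : α ≠ 0) : ¬ (C α * X + C β) ^ p ∣ ∑ k ∈ Finset.range (d + 1), C (b k) * X ^ (d - k) := by
  have hcoeff : ∀ n, (∑ k ∈ Finset.range (d + 1), C (b k) * X ^ (d - k)).coeff n = if n ≤ d then b (d - n) else 0 := by
    intro n
    rw [residuePoly_reflect, finsetSum_coeff]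
    simp only [coeff_C_mul_X_pow]
    by_cases hn : n ≤ d
    · rw [if_pos hn, Finset.sum_eq_single n, if_pos rfl]
      · intro k _ hk; rw [if_neg (Ne.symm hk)]
      · intro h; exact absurd (Finset.mem_range.mpr (Nat.lt_succ_of_le hn)) h
    · rw [if_neg hn]
      refine Finset.sum_eq_zero fun k hk => ?_
      rw [if_neg]
      intro h; subst h
      exact hn (Nat.lt_succ_iff.mp (Finset.mem_range.mp hk))
  refine not_linear_pow_dvd_of_natDegree_lt ?_ ?_ hα
  · obtain ⟨j, hj, hbj⟩ := hne
    intro h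
    have := hcoeff (d - j)
    rw [h, coeff_zero, if_pos (Nat.sub_le d j), Nat.sub_sub_self hj] at this
    exact hbj this.symm
  · -- degree `≤ d - p < p`: the coefficients of `X^n`, `n > d - p`, are `b (d - n)` with `d - n < p`
    have hle : (∑ k ∈ Finset.range (d + 1), C (b k) * X ^ (d - k)).natDegree ≤ d - p := by
      rw [natDegree_le_iff_coeff_eq_zero]
      intro n hn
      rw [hcoeff]
      by_cases hnd : n ≤ d
      · rw [if_pos hnd]
        have : (d - p : ℕ) < n := by exact_mod_cast hn
        exact hb _ (by omega)
      · rw [if_neg hnd]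
    omega

end Poly

end MohWindowSurface

/-! ## 2. The origin chart of a non-dropping child -/

section Campaign

variable {p : ℕ} [Fact p.Prime] {K : Type u} [Field K] [CharP K p]
variable {A A' : AmbientDatum p K} {E : IdealExponent A.Z}

set_option maxHeartbeats 800000 in
-- two chart-family lemmas over `CommRingCat.of` stalks in one proof
/-- **[OURS · L1 W4.6 rung (iii-2), every `p`] THE ORIGIN CHART OF A NON-DROPPING CHILD.** Let `π` be a §2.1-permissible blow-up of a state of
`Regime.mohWindowSurface` with transform again in the regime, and `x′ ∈ Sing(E′)` a point over the centre point `s` with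
`residualOrder(J′_{x′}) ≥ residualOrder(J_s)`. Then there is a coefficient window presentation `c = (x, y, z)` of `𝔪_s`,
`J_s = (z^p + Σ_{i ≤ d} a_i x^{d−i} y^i)`, `p < d < 2p`, a unit among the `a_i`, in HEAVY NORMAL FORM (`a_i ∈ 𝔪_s` for `i < p`), and a chart
morphism `q : Spec B_0 → Z′` of the Rees chart `x` of `c` over `Spec 𝒪_{Z,s}`, computing the local ring at a prime `w` with `q w = x′` and
`x, y/x, z/x ∈ w` — `x′` IS THE ORIGIN of the chart `x`. NOT a statement of the manuscript. [folklore] -/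
theorem exists_originChart_of_le_residualOrder {D : Closeds A.Z} (π : A'.Z ⟶ A.Z) (hπ : IsBlowup π (vanishingIdeal D))
    (hD : E.IsPermissibleCentre A.hom D) (hRg : Regime.mohWindowSurface A E)
    (hRg' : Regime.mohWindowSurface A' (E.transform π D)) {x' : A'.Z} (hx' : x' ∈ (E.transform π D).sing) {s : A.Z}
    (hs : π.base x' = s) (hsD : s ∈ (D : Set A.Z))
    (hle : (residualOrder E.b (A.Z.presheaf.stalk s) (stalkIdeal E.J s)).toNat ≤
      (residualOrder (E.transform π D).b (A'.Z.presheaf.stalk x') (stalkIdeal (E.transform π D).J x')).toNat) :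
    ∃ (c : Fin 3 → A.Z.presheaf.stalk s) (d : ℕ) (a : ℕ → A.Z.presheaf.stalk s),
      Ideal.span (Set.range c) = maximalIdeal _ ∧ p < d ∧ d < 2 * p ∧ (∃ i ≤ d, IsUnit (a i)) ∧ (∀ i < p, a i ∈ maximalIdeal _) ∧
      stalkIdeal E.J s = Ideal.span {c 2 ^ p + ∑ i ∈ Finset.range (d + 1), a i * c 0 ^ (d - i) * c 1 ^ i} ∧
      ∃ (q : Spec (.of (chartRing c 0)) ⟶ A'.Z) (w : Spec (.of (chartRing c 0))),
        q w = x' ∧ IsIso (q.stalkMap w) ∧ q ≫ π = Spec.map (CommRingCat.ofHom (chartBase c 0)) ≫ A.Z.fromSpecStalk s ∧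
        chartBase c 0 (c 0) ∈ w.asIdeal ∧ chartGen c 0 1 ∈ w.asIdeal ∧ chartGen c 0 2 ∈ w.asIdeal := by
  classical
  have hb : E.b = p := hRg.1
  have hsS : s ∈ E.sing := hD.subset_sing hsD
  -- a presentation at `s` from the regime
  obtain ⟨hRreg, h3, x, y, z, hxyz, d, a, hbd, hd2, hunit, hJ⟩ := hRg.2.2.2 s hsS
  rw [hb] at hbd hd2 hJ
  haveI := hRreg
  -- Step 1: a presentation `(x₁, y₁, z; a₁)` whose chart-`x` residue polynomial has a `κ`-rational `p`-fold root `λ̄`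
  have step1 : ∃ (x₁ y₁ : A.Z.presheaf.stalk s) (a₁ : ℕ → A.Z.presheaf.stalk s) (l : A.Z.presheaf.stalk s),
      Ideal.span {x₁, y₁, z} = maximalIdeal _ ∧ (∃ i ≤ d, IsUnit (a₁ i)) ∧
      stalkIdeal E.J s = Ideal.span {z ^ p + ∑ i ∈ Finset.range (d + 1), a₁ i * x₁ ^ (d - i) * y₁ ^ i} ∧
      (X - C (residue _ l)) ^ p ∣ ∑ k ∈ Finset.range (d + 1), C (residue _ (a₁ k)) * X ^ k := by
    have hc : Ideal.span (Set.range ![x, y, z]) = maximalIdeal _ := by rw [MohWindowSurface.range_vec3]; exact hxyz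
    have hJc : stalkIdeal E.J s = Ideal.span {(![x, y, z] : Fin 3 → _) 2 ^ p +
        ∑ i ∈ Finset.range (d + 1), a i * (![x, y, z] : Fin 3 → _) 0 ^ (d - i) * (![x, y, z] : Fin 3 → _) 1 ^ i} := by
      rw [hJ]; rfl
    obtain ⟨j, -, w, hj2, -, -, -, -, -, α, β, hα, hdvd, -⟩ :=
      exists_chart_heavyRoot_of_le_residualOrder π hπ hD hRg hRg' hx' hs hsD hle ![x, y, z] hc hbd hd2 a hunit hJc
    -- the heavy root `λ̄ = -β̄/ᾱ`; `(X - C λ̄)^p` is a unit multiple of `(ᾱ X + β̄)^p`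
    obtain ⟨αu, hαu⟩ := hα
    have hαres : residue _ α ≠ 0 := (residue_ne_zero_iff_isUnit _).mpr ⟨αu, hαu⟩
    set lam : A.Z.presheaf.stalk s := -(β * ↑αu⁻¹) with hlam
    have hroot : X - C (residue _ lam) = C (residue _ α)⁻¹ * (C (residue _ α) * X + C (residue _ β)) := by
      have hinv : residue _ (↑αu⁻¹ : A.Z.presheaf.stalk s) = (residue _ α)⁻¹ := by
        rw [← hαu]; exact eq_inv_of_mul_eq_one_left (by rw [← map_mul, Units.inv_mul, map_one])
      have hC1 : C (residue (A.Z.presheaf.stalk s) α)⁻¹ * C (residue _ α) = (1 : (ResidueField (A.Z.presheaf.stalk s))[X]) := by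
        rw [← map_mul, inv_mul_cancel₀ hαres, map_one]
      rw [hlam, map_neg, map_mul, hinv, map_neg, sub_neg_eq_add, mul_add, ← mul_assoc, hC1, one_mul, ← map_mul, mul_comm _ (residue _ β)]
    have hdvdX : ∀ G : (ResidueField (A.Z.presheaf.stalk s))[X], (C (residue _ α) * X + C (residue _ β)) ^ p ∣ G →
        (X - C (residue _ lam)) ^ p ∣ G := fun G hG => by
      rw [hroot, mul_pow, ← map_pow]
      exact ((isUnit_C.mpr ((IsUnit.mk0 _ (inv_ne_zero hαres)).pow p)).mul_left_dvd).mpr hG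
    -- which chart saw the root?
    obtain rfl | rfl : j = 0 ∨ j = 1 := by
      rcases j with ⟨j, hj⟩
      have : j = 0 ∨ j = 1 ∨ j = 2 := by omega
      rcases this with rfl | rfl | rfl
      · exact Or.inl rfl
      · exact Or.inr rfl
      · exact absurd rfl hj2
    · -- chart `x`: the residue polynomial `Σ ā_k X^k` itself
      refine ⟨x, y, a, lam, hxyz, hunit, hJ, hdvdX _ ?_⟩
      have h := hdvd
      simp only [Matrix.cons_val_zero] at h
      rwa [← residue_sum_chart_zero] at h
    · -- chart `y`: swap `x ↔ y`
      refine ⟨y, x, fun k => a (d - k), lam, by rw [← hxyz, Set.insert_comm], ?_, ?_, hdvdX _ ?_⟩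
      · obtain ⟨i, hi, hiu⟩ := hunit
        exact ⟨d - i, Nat.sub_le d i, by show IsUnit (a (d - (d - i))); rwa [Nat.sub_sub_self hi]⟩
      · rw [hJ, MohWindowSurface.coeffForm_swap]
      · have h := hdvd
        simp only [Matrix.cons_val_one, Matrix.cons_val_zero] at h
        rwa [MohWindowSurface.residuePoly_reflect] at h
  obtain ⟨x₁, y₁, a₁, l, hxyz₁, hunit₁, hJ₁, hdvd₁⟩ := step1
  -- Step 2: shear to the heavy normal form
  obtain ⟨y₂, a₂, hxyz₂, hunit₂, hsmall, hsum, hF₂⟩ := MohWindowSurface.exists_heavy_normal_form hxyz₁ a₁ hunit₁ l hdvd₁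
  have hJ₂ : stalkIdeal E.J s = Ideal.span {z ^ p + ∑ i ∈ Finset.range (d + 1), a₂ i * x₁ ^ (d - i) * y₂ ^ i} := by
    rw [hJ₁, hsum]
  set c : Fin 3 → A.Z.presheaf.stalk s := ![x₁, y₂, z] with hc_def
  have hc : Ideal.span (Set.range c) = maximalIdeal _ := by rw [hc_def, MohWindowSurface.range_vec3]; exact hxyz₂
  have hJc : stalkIdeal E.J s = Ideal.span {c 2 ^ p + ∑ i ∈ Finset.range (d + 1), a₂ i * c 0 ^ (d - i) * c 1 ^ i} := by
    rw [hJ₂, hc_def]; rfl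
  -- Step 3: the point in the charts of `c`: on the line over a heavy root of the NORMAL FORM, which can only be `0` in the chart `x`
  obtain ⟨j, q, w, hj2, hqw, hiso, hsq, hcj, h2, α, β, hα, hdvd, hmem⟩ :=
    exists_chart_heavyRoot_of_le_residualOrder π hπ hD hRg hRg' hx' hs hsD hle c hc hbd hd2 a₂ hunit₂ hJc
  have hαres : residue _ α ≠ 0 := (residue_ne_zero_iff_isUnit _).mpr hα
  -- the residues of the normal-form coefficients vanish below `p`, and some residue is nonzero
  have hres0 : ∀ i < p, residue (A.Z.presheaf.stalk s) (a₂ i) = 0 := fun i hi => (residue_eq_zero_iff _).mpr (hsmall i hi)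
  have hresne : ∃ i ≤ d, residue (A.Z.presheaf.stalk s) (a₂ i) ≠ 0 := by
    obtain ⟨i, hi, hiu⟩ := hunit₂
    exact ⟨i, hi, (residue_ne_zero_iff_isUnit _).mpr hiu⟩
  have hj0 : j = 0 := by
    obtain rfl | rfl : j = 0 ∨ j = 1 := by
      rcases j with ⟨j, hj⟩
      have : j = 0 ∨ j = 1 ∨ j = 2 := by omega
      rcases this with rfl | rfl | rfl
      · exact Or.inl rfl
      · exact Or.inr rfl
      · exact absurd rfl hj2
    · rfl
    · -- chart `y` is impossible: the reversal of the normal form has no `p`-fold linear factor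
      exfalso
      have h := hdvd
      simp only [Matrix.cons_val_one, Matrix.cons_val_zero] at h
      exact MohWindowSurface.not_linear_pow_dvd_reflect hd2 (fun i => residue _ (a₂ i)) hres0 hresne hαres h
  subst hj0
  -- in the chart `x`: `X^p ∣ F₂` and `(ᾱX + β̄)^p ∣ F₂` force `β̄ = 0`
  have hF0 : (∑ k ∈ Finset.range (d + 1), C (residue (A.Z.presheaf.stalk s) (a₂ k)) * X ^ k) ≠ 0 := by
    obtain ⟨i, hi, hine⟩ := hresne
    intro h
    have := MohWindowSurface.coeff_residuePoly d (fun k => residue _ (a₂ k)) (fun k => k) (fun _ _ _ _ hkk' => hkk') hi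
    rw [h, coeff_zero] at this
    exact hine this.symm
  have hFdeg : (∑ k ∈ Finset.range (d + 1), C (residue (A.Z.presheaf.stalk s) (a₂ k)) * X ^ k).natDegree < 2 * p :=
    (natDegree_sum_le_of_forall_le _ _ fun k hk =>
      (natDegree_C_mul_X_pow_le _ k).trans (Nat.lt_succ_iff.mp (Finset.mem_range.mp hk))).trans_lt hd2
  have hXp : X ^ p ∣ ∑ k ∈ Finset.range (d + 1), C (residue (A.Z.presheaf.stalk s) (a₂ k)) * X ^ k := by
    rw [X_pow_dvd_iff]
    intro i hi
    by_cases hid : i ≤ d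
    · rw [MohWindowSurface.coeff_residuePoly d (fun k => residue _ (a₂ k)) (fun k => k) (fun _ _ _ _ hkk' => hkk') hid]
      exact hres0 i hi
    · rw [finsetSum_coeff]
      refine Finset.sum_eq_zero fun k hk => ?_
      rw [coeff_C_mul_X_pow, if_neg]
      intro h; subst h
      exact hid (Nat.lt_succ_iff.mp (Finset.mem_range.mp hk))
  have hβ : residue (A.Z.presheaf.stalk s) β = 0 := by
    have h := hdvd
    simp only [Matrix.cons_val_zero] at h
    rw [← residue_sum_chart_zero] at h
    exact MohWindowSurface.eq_zero_of_X_pow_dvd_of_linear_pow_dvd hF0 hFdeg hXp hαres h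
  -- hence `y/x ∈ w`: `α · (y/x) + β ∈ w`, `β ∈ 𝔪_s ⊆ comap w`, `α` a unit
  have hmem' : chartBase c 0 α * chartGen c 0 1 + chartBase c 0 β ∈ w.asIdeal := by
    simpa only [Matrix.cons_val_zero] using hmem
  have hβ𝔪 : β ∈ maximalIdeal (A.Z.presheaf.stalk s) := (residue_eq_zero_iff _).mp hβ
  have hcomap : ∀ r ∈ maximalIdeal (A.Z.presheaf.stalk s), chartBase c 0 r ∈ w.asIdeal := by
    intro r hr
    rw [← hc] at hr
    -- `r ∈ (c₀, c₁, c₂)` and `chartBase c_i = chartBase c₀ · e_i ∈ w`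
    have hci : ∀ i, chartBase c 0 (c i) ∈ w.asIdeal := fun i => by
      rw [reesChartBase_apply_eq_mul_chartGen c 0 i]
      exact Ideal.mul_mem_right _ _ hcj
    have : Ideal.map (chartBase c 0) (Ideal.span (Set.range c)) ≤ w.asIdeal := by
      rw [Ideal.map_span, Ideal.span_le]
      rintro _ ⟨_, ⟨i, rfl⟩, rfl⟩
      exact hci i
    exact this (Ideal.mem_map_of_mem _ hr)
  have hαnot : chartBase c 0 α ∉ w.asIdeal := fun h =>
    w.isPrime.ne_top (Ideal.eq_top_of_isUnit_mem _ h (hα.map (chartBase c 0)))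
  -- read in the domain `B_0 / w`
  have he1 : chartGen c 0 1 ∈ w.asIdeal := by
    haveI : w.asIdeal.IsPrime := w.isPrime
    have h1 : Ideal.Quotient.mk w.asIdeal (chartBase c 0 α * chartGen c 0 1 + chartBase c 0 β) = 0 :=
      Ideal.Quotient.eq_zero_iff_mem.mpr hmem'
    rw [map_add, map_mul, Ideal.Quotient.eq_zero_iff_mem.mpr (hcomap β hβ𝔪), add_zero] at h1
    rcases mul_eq_zero.mp h1 with h | h
    · exact absurd (Ideal.Quotient.eq_zero_iff_mem.mp h) hαnot
    · exact Ideal.Quotient.eq_zero_iff_mem.mp h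
  exact ⟨c, d, a₂, hc, hbd, hd2, hunit₂, hsmall, hJc, q, w, hqw, hiso, hsq, hcj, he1, h2⟩

end Campaign

end CampaignW46

end Summit.ResolutionOfSingularities.ResolutionOfSingularities.Theorems

end
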